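import Literature.AlgebraicGeometry.Motives.FamiliesVHSConstant
import Literature.AlgebraicGeometry.Motives.FamiliesVHSTateTwist
import Literature.AlgebraicGeometry.Motives.HodgeStructureTensorConstraints
import HarnessLib

/-!
# The constraints of the `⊗`-category of VHS data: commutativity `D₁ ⊗ D₂ ≅ D₂ ⊗ D₁`, associativity `(D₁ ⊗ D₂) ⊗ D₃ ≅ D₁ ⊗ (D₂ ⊗ D₃)`,
# the Tate twist as a tensor product `ℤ_S(j) ⊗ D ≅ D(j)`, and the unitors `ℤ_S ⊗ D ≅ D ≅ D ⊗ ℤ_S` — as mutually inverse morphisms of VHS data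

Topic `Literature/AlgebraicGeometry/Motives` (namespaces `Literature.AlgebraicGeometry.Motives.LocalSystem`, `….Motives.VHSData`), lane
`lit-hodgefound` (seat `p08`, row g57-#5).  DEFINITIONS WITH BODIES (the fibrewise constraint maps of local systems `LocalSystem.tensorCommMap`,
`tensorAssocMap ∕ tensorAssocInvMap`, `unitTensorMap ∕ unitTensorInvMap`, `tensorUnitMap ∕ tensorUnitInvMap`, stated over a general commutative ring;
the morphisms of VHS data `Hom.tensorComm ∕ tensorCommSymm`, `Hom.tensorAssoc ∕ tensorAssocSymm`, `Hom.tateTensor ∕ tateTensorSymm`,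
`Hom.unitTensor ∕ unitTensorSymm`, `Hom.tensorUnit ∕ tensorUnitSymm`) and their API; no named fact, no instance, no notation (D-0026 net debt `0`).
Sequel of `Motives/FamiliesVHSTensor` (`D₁ ⊗ D₂`), `Motives/FamiliesVHSConstant` (`ℤ_S(j)`, `ℤ_S`), `Motives/FamiliesVHSTateTwist` (`D(j)`),
`Motives/FamiliesVHSMorphism` (`VHSData.Hom`); the Hodge-theoretic input is the tree's `Motives/HodgeStructureTensorConstraints` (the constraints
`Hom.tensorComm`, `Hom.tensorAssoc`, `Hom.tateTensor`, `Hom.tensorLid`, `Hom.tensorRid` of `ℚ`-Hodge structures over the fibre functor).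

PRINTED SOURCES.  P. Deligne, *Équations différentielles à points singuliers réguliers*, LNM 163 (1970), I.1: the local systems on `S` form a
`⊗`-category («forment une `⊗`-catégorie … avec objet unité»), the constraints being those of modules fibrewise.  P. Deligne, J. Milne, *Tannakian
categories*, LNM 900 (1982), §1 Def. 1.1 (associativity ∕ commutativity constraints, identity object), Prop. 1.3 (unitors), Ex. 2.31 (Hodge
structures form a rigid tensor category).  P. Deligne, *Théorie de Hodge II*, 1.1.12 (`⊗` of filtered objects), 2.1.13–2.1.14 (`H(n) := H ⊗ ℤ(n)`).
B. Moonen, *Families of motives and the Mumford–Tate conjecture*, §2.1 («we write `H(n)` for `H ⊗ ℚ(n)`»).  W. Schmid, *Variation of Hodge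
structure*, §2 ∕ P. Griffiths, *Periods of integrals III*, §1: variations are stable under the tensor operations.

* §0 **local systems over a commutative ring `R`** (generic `R`, so that no instance search on a tensor type over `ℤ` ever happens): the fibrewise
  linear maps `tensorCommMap` (`v₁ ⊗ v₂ ↦ v₂ ⊗ v₁`), `tensorAssocMap ∕ tensorAssocInvMap`, `unitTensorMap` (`r ⊗ v ↦ r·v` out of `R_S ⊗ V`) ∕
  `unitTensorInvMap` (`v ↦ 1 ⊗ v`), `tensorUnitMap ∕ tensorUnitInvMap`, their values on pure tensors (`rfl`), their COMPATIBILITY WITH TRANSPORT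
  (`…_comp_transport`, `…_transport`) and the inverse identities.
* §1 **`Hom.tensorComm D₁ D₂ : D₁ ⊗ D₂ → (D₂ ⊗ D₁).cast`** and `Hom.tensorCommSymm` (`homRat_tensorComm`; Hodge by the tree's `HodgeStructure.Hom.tensorComm`),
  the two composite identities, `isHodgeAt_tensorComm_app`.
* §2 **`Hom.tensorAssoc D₁ D₂ D₃ : (D₁ ⊗ D₂) ⊗ D₃ → (D₁ ⊗ (D₂ ⊗ D₃)).cast`** and `Hom.tensorAssocSymm` (`homRat_tensorAssoc ∕ _Symm`; the tree's
  `Hom.tensorAssoc`), with the two composite identities.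
* §3 **`Hom.tateTensor j D : ℤ_S(j) ⊗ D → D(j).cast`** and `Hom.tateTensorSymm` (`r ⊗ u ↦ r·u`; `homRat_tateTensor ∕ _Symm`; the tree's `Hom.tateTensor`),
  the composite identities, and **`isHodgeAt_tateTensor_one_tmul_iff`**: `1 ⊗ u` is a Hodge class of level `p` of `ℤ_S(j) ⊗ D` iff `u` is one of level
  `p + j` of `D`.
* §4 **the unitors `Hom.unitTensor D : ℤ_S ⊗ D → D.cast`, `Hom.tensorUnit D : D ⊗ ℤ_S → D.cast`** with inverses (the tree's `Hom.tensorLid ∕ tensorRid`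
  for the identity object `ℚ(0)`).

HONEST SCOPE: as for every `VHSData`, holomorphy ∕ transversality are not recorded; no monoidal-category instance is declared — the constraints are
the explicit, mutually inverse morphisms a consumer composes with.

## References

* [Deligne1970] P. Deligne, *Équations différentielles à points singuliers réguliers*, LNM 163 (1970), I.1.
* [DeligneMilne1982Tannakian] P. Deligne, J. S. Milne, *Tannakian categories*, in LNM 900 (1982), §1 Def. 1.1, Prop. 1.3, Ex. 2.31.
* [DeligneHodgeII1971] P. Deligne, *Théorie de Hodge II*, Publ. Math. IHÉS 40 (1971), 1.1.12, 2.1.13–2.1.14.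
* [Moonen2017FamiliesMotives] B. Moonen, *Families of motives and the Mumford–Tate conjecture*, Milan J. Math. 85 (2017), §2.1.
* [Schmid1973] W. Schmid, *Variation of Hodge structure: the singularities of the period mapping*, Invent. Math. 22 (1973), §2.
* [Griffiths1970] P. Griffiths, *Periods of integrals on algebraic manifolds III*, Publ. Math. IHÉS 38 (1970), §1.
-/

noncomputable section

open CategoryTheory
open scoped TensorProduct

universe u

namespace Literature.AlgebraicGeometry.Motives

/-! ## §0 The constraint maps of local systems over a commutative ring, fibrewise, and their compatibility with transport -/

namespace LocalSystem

variable {R : Type u} [CommRing R] {S : Type u} [TopologicalSpace S]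

/-- **`v₁ ⊗ v₂ ↦ v₂ ⊗ v₁` on the fibres of `V₁ ⊗ V₂`** (Mathlib `TensorProduct.comm`). [cite: Deligne1970, I.1] -/
def tensorCommMap (V₁ V₂ : LocalSystem R S) (s : S) : (V₁.tensor V₂).fiber s →ₗ[R] (V₂.tensor V₁).fiber s :=
  (TensorProduct.comm R (V₁.fiber s) (V₂.fiber s)).toLinearMap

/-- `tensorCommMap (v₁ ⊗ v₂) = v₂ ⊗ v₁`. [cite: Deligne1970, I.1] -/
@[simp] theorem tensorCommMap_tmul (V₁ V₂ : LocalSystem R S) (s : S) (v₁ : V₁.fiber s) (v₂ : V₂.fiber s) :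
    tensorCommMap V₁ V₂ s (v₁ ⊗ₜ[R] v₂) = v₂ ⊗ₜ[R] v₁ := rfl

/-- **`comm` is flat**: `comm ∘ (γ ⊗ γ) = (γ ⊗ γ) ∘ comm`. [cite: Deligne1970, I.1] -/
theorem tensorCommMap_comp_transport (V₁ V₂ : LocalSystem R S) {s t : S} (γ : Path.Homotopic.Quotient s t) :
    tensorCommMap V₁ V₂ t ∘ₗ (V₁.tensor V₂).transport γ = (V₂.tensor V₁).transport γ ∘ₗ tensorCommMap V₁ V₂ s :=
  TensorProduct.ext' fun _ _ => rfl

/-- Pointwise form of `tensorCommMap_comp_transport`. [cite: Deligne1970, I.1] -/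
theorem tensorCommMap_transport (V₁ V₂ : LocalSystem R S) {s t : S} (γ : Path.Homotopic.Quotient s t) (z : (V₁.tensor V₂).fiber s) :
    tensorCommMap V₁ V₂ t ((V₁.tensor V₂).transport γ z) = (V₂.tensor V₁).transport γ (tensorCommMap V₁ V₂ s z) :=
  LinearMap.congr_fun (tensorCommMap_comp_transport V₁ V₂ γ) z

/-- `comm ∘ comm = id`. [cite: Deligne1970, I.1] -/
theorem tensorCommMap_tensorCommMap (V₁ V₂ : LocalSystem R S) (s : S) (z : (V₁.tensor V₂).fiber s) :
    tensorCommMap V₂ V₁ s (tensorCommMap V₁ V₂ s z) = z :=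
  (TensorProduct.comm R (V₁.fiber s) (V₂.fiber s)).symm_apply_apply z

/-- **`(v₁ ⊗ v₂) ⊗ v₃ ↦ v₁ ⊗ (v₂ ⊗ v₃)` on the fibres** (Mathlib `TensorProduct.assoc`). [cite: Deligne1970, I.1] -/
def tensorAssocMap (V₁ V₂ V₃ : LocalSystem R S) (s : S) : ((V₁.tensor V₂).tensor V₃).fiber s →ₗ[R] (V₁.tensor (V₂.tensor V₃)).fiber s :=
  (TensorProduct.assoc R (V₁.fiber s) (V₂.fiber s) (V₃.fiber s)).toLinearMap

/-- **`v₁ ⊗ (v₂ ⊗ v₃) ↦ (v₁ ⊗ v₂) ⊗ v₃` on the fibres** (`(TensorProduct.assoc).symm`). [cite: Deligne1970, I.1] -/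
def tensorAssocInvMap (V₁ V₂ V₃ : LocalSystem R S) (s : S) : (V₁.tensor (V₂.tensor V₃)).fiber s →ₗ[R] ((V₁.tensor V₂).tensor V₃).fiber s :=
  (TensorProduct.assoc R (V₁.fiber s) (V₂.fiber s) (V₃.fiber s)).symm.toLinearMap

/-- `tensorAssocMap ((v₁ ⊗ v₂) ⊗ v₃) = v₁ ⊗ (v₂ ⊗ v₃)`. [cite: Deligne1970, I.1] -/
@[simp] theorem tensorAssocMap_tmul (V₁ V₂ V₃ : LocalSystem R S) (s : S) (v₁ : V₁.fiber s) (v₂ : V₂.fiber s) (v₃ : V₃.fiber s) :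
    tensorAssocMap V₁ V₂ V₃ s ((v₁ ⊗ₜ[R] v₂) ⊗ₜ[R] v₃) = v₁ ⊗ₜ[R] (v₂ ⊗ₜ[R] v₃) := rfl

/-- `tensorAssocInvMap (v₁ ⊗ (v₂ ⊗ v₃)) = (v₁ ⊗ v₂) ⊗ v₃`. [cite: Deligne1970, I.1] -/
@[simp] theorem tensorAssocInvMap_tmul (V₁ V₂ V₃ : LocalSystem R S) (s : S) (v₁ : V₁.fiber s) (v₂ : V₂.fiber s) (v₃ : V₃.fiber s) :
    tensorAssocInvMap V₁ V₂ V₃ s (v₁ ⊗ₜ[R] (v₂ ⊗ₜ[R] v₃)) = (v₁ ⊗ₜ[R] v₂) ⊗ₜ[R] v₃ := rfl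

/-- **`assoc` is flat.** [cite: Deligne1970, I.1] -/
theorem tensorAssocMap_comp_transport (V₁ V₂ V₃ : LocalSystem R S) {s t : S} (γ : Path.Homotopic.Quotient s t) :
    tensorAssocMap V₁ V₂ V₃ t ∘ₗ ((V₁.tensor V₂).tensor V₃).transport γ = (V₁.tensor (V₂.tensor V₃)).transport γ ∘ₗ tensorAssocMap V₁ V₂ V₃ s :=
  TensorProduct.ext_threefold fun _ _ _ => rfl

/-- Pointwise form of `tensorAssocMap_comp_transport`. [cite: Deligne1970, I.1] -/
theorem tensorAssocMap_transport (V₁ V₂ V₃ : LocalSystem R S) {s t : S} (γ : Path.Homotopic.Quotient s t) (z : ((V₁.tensor V₂).tensor V₃).fiber s) :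
    tensorAssocMap V₁ V₂ V₃ t (((V₁.tensor V₂).tensor V₃).transport γ z) = (V₁.tensor (V₂.tensor V₃)).transport γ (tensorAssocMap V₁ V₂ V₃ s z) :=
  LinearMap.congr_fun (tensorAssocMap_comp_transport V₁ V₂ V₃ γ) z

/-- **`assoc⁻¹` is flat.** [cite: Deligne1970, I.1] -/
theorem tensorAssocInvMap_comp_transport (V₁ V₂ V₃ : LocalSystem R S) {s t : S} (γ : Path.Homotopic.Quotient s t) :
    tensorAssocInvMap V₁ V₂ V₃ t ∘ₗ (V₁.tensor (V₂.tensor V₃)).transport γ = ((V₁.tensor V₂).tensor V₃).transport γ ∘ₗ tensorAssocInvMap V₁ V₂ V₃ s :=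
  TensorProduct.ext_threefold' fun _ _ _ => rfl

/-- Pointwise form of `tensorAssocInvMap_comp_transport`. [cite: Deligne1970, I.1] -/
theorem tensorAssocInvMap_transport (V₁ V₂ V₃ : LocalSystem R S) {s t : S} (γ : Path.Homotopic.Quotient s t) (z : (V₁.tensor (V₂.tensor V₃)).fiber s) :
    tensorAssocInvMap V₁ V₂ V₃ t ((V₁.tensor (V₂.tensor V₃)).transport γ z) = ((V₁.tensor V₂).tensor V₃).transport γ (tensorAssocInvMap V₁ V₂ V₃ s z) :=
  LinearMap.congr_fun (tensorAssocInvMap_comp_transport V₁ V₂ V₃ γ) z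

/-- `assoc⁻¹ ∘ assoc = id`. [cite: Deligne1970, I.1] -/
theorem tensorAssocInvMap_tensorAssocMap (V₁ V₂ V₃ : LocalSystem R S) (s : S) (z : ((V₁.tensor V₂).tensor V₃).fiber s) :
    tensorAssocInvMap V₁ V₂ V₃ s (tensorAssocMap V₁ V₂ V₃ s z) = z :=
  (TensorProduct.assoc R (V₁.fiber s) (V₂.fiber s) (V₃.fiber s)).symm_apply_apply z

/-- `assoc ∘ assoc⁻¹ = id`. [cite: Deligne1970, I.1] -/
theorem tensorAssocMap_tensorAssocInvMap (V₁ V₂ V₃ : LocalSystem R S) (s : S) (z : (V₁.tensor (V₂.tensor V₃)).fiber s) :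
    tensorAssocMap V₁ V₂ V₃ s (tensorAssocInvMap V₁ V₂ V₃ s z) = z :=
  (TensorProduct.assoc R (V₁.fiber s) (V₂.fiber s) (V₃.fiber s)).apply_symm_apply z

/-- **`r ⊗ v ↦ r · v` on the fibres of `R_S ⊗ V`**, `R_S` the constant local system of rank one (Mathlib `TensorProduct.lid`). [cite: Deligne1970, I.1] -/
def unitTensorMap (V : LocalSystem R S) (s : S) : ((const R S (ModuleCat.of R R)).tensor V).fiber s →ₗ[R] V.fiber s :=
  (TensorProduct.lid R (V.fiber s)).toLinearMap

/-- **`v ↦ 1 ⊗ v` into the fibres of `R_S ⊗ V`** (`(TensorProduct.lid).symm`). [cite: Deligne1970, I.1] -/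
def unitTensorInvMap (V : LocalSystem R S) (s : S) : V.fiber s →ₗ[R] ((const R S (ModuleCat.of R R)).tensor V).fiber s :=
  (TensorProduct.lid R (V.fiber s)).symm.toLinearMap

/-- `unitTensorMap (r ⊗ v) = r · v`. [cite: Deligne1970, I.1] -/
@[simp] theorem unitTensorMap_tmul (V : LocalSystem R S) (s : S) (r : R) (v : V.fiber s) : unitTensorMap V s (r ⊗ₜ[R] v) = r • v := rfl

/-- `unitTensorInvMap v = 1 ⊗ v`. [cite: Deligne1970, I.1] -/
theorem unitTensorInvMap_apply (V : LocalSystem R S) (s : S) (v : V.fiber s) : unitTensorInvMap V s v = (1 : R) ⊗ₜ[R] v := rfl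

/-- **`lid` is flat**: `r · (γ v) = γ (r · v)` (transport of `R_S` is the identity, transport of `V` is linear). [cite: Deligne1970, I.1] -/
theorem unitTensorMap_comp_transport (V : LocalSystem R S) {s t : S} (γ : Path.Homotopic.Quotient s t) :
    unitTensorMap V t ∘ₗ ((const R S (ModuleCat.of R R)).tensor V).transport γ = V.transport γ ∘ₗ unitTensorMap V s :=
  TensorProduct.ext' fun r v => by
    change r • V.transport γ v = V.transport γ (r • v)
    rw [map_smul]

/-- Pointwise form of `unitTensorMap_comp_transport`. [cite: Deligne1970, I.1] -/
theorem unitTensorMap_transport (V : LocalSystem R S) {s t : S} (γ : Path.Homotopic.Quotient s t) (z : ((const R S (ModuleCat.of R R)).tensor V).fiber s) :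
    unitTensorMap V t (((const R S (ModuleCat.of R R)).tensor V).transport γ z) = V.transport γ (unitTensorMap V s z) :=
  LinearMap.congr_fun (unitTensorMap_comp_transport V γ) z

/-- **`lid⁻¹` is flat**: `1 ⊗ γ v = (γ ⊗ γ)(1 ⊗ v)`. [cite: Deligne1970, I.1] -/
theorem unitTensorInvMap_transport (V : LocalSystem R S) {s t : S} (γ : Path.Homotopic.Quotient s t) (v : V.fiber s) :
    unitTensorInvMap V t (V.transport γ v) = ((const R S (ModuleCat.of R R)).tensor V).transport γ (unitTensorInvMap V s v) := rfl

/-- `lid⁻¹ ∘ lid = id`. [cite: Deligne1970, I.1] -/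
theorem unitTensorInvMap_unitTensorMap (V : LocalSystem R S) (s : S) (z : ((const R S (ModuleCat.of R R)).tensor V).fiber s) :
    unitTensorInvMap V s (unitTensorMap V s z) = z :=
  (TensorProduct.lid R (V.fiber s)).symm_apply_apply z

/-- `lid ∘ lid⁻¹ = id`. [cite: Deligne1970, I.1] -/
theorem unitTensorMap_unitTensorInvMap (V : LocalSystem R S) (s : S) (v : V.fiber s) : unitTensorMap V s (unitTensorInvMap V s v) = v :=
  (TensorProduct.lid R (V.fiber s)).apply_symm_apply v

/-- **`v ⊗ r ↦ r · v` on the fibres of `V ⊗ R_S`** (Mathlib `TensorProduct.rid`). [cite: Deligne1970, I.1] -/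
def tensorUnitMap (V : LocalSystem R S) (s : S) : (V.tensor (const R S (ModuleCat.of R R))).fiber s →ₗ[R] V.fiber s :=
  (TensorProduct.rid R (V.fiber s)).toLinearMap

/-- **`v ↦ v ⊗ 1` into the fibres of `V ⊗ R_S`** (`(TensorProduct.rid).symm`). [cite: Deligne1970, I.1] -/
def tensorUnitInvMap (V : LocalSystem R S) (s : S) : V.fiber s →ₗ[R] (V.tensor (const R S (ModuleCat.of R R))).fiber s :=
  (TensorProduct.rid R (V.fiber s)).symm.toLinearMap

/-- `tensorUnitMap (v ⊗ r) = r · v`. [cite: Deligne1970, I.1] -/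
@[simp] theorem tensorUnitMap_tmul (V : LocalSystem R S) (s : S) (v : V.fiber s) (r : R) : tensorUnitMap V s (v ⊗ₜ[R] r) = r • v := rfl

/-- `tensorUnitInvMap v = v ⊗ 1`. [cite: Deligne1970, I.1] -/
theorem tensorUnitInvMap_apply (V : LocalSystem R S) (s : S) (v : V.fiber s) : tensorUnitInvMap V s v = v ⊗ₜ[R] (1 : R) := rfl

/-- **`rid` is flat.** [cite: Deligne1970, I.1] -/
theorem tensorUnitMap_comp_transport (V : LocalSystem R S) {s t : S} (γ : Path.Homotopic.Quotient s t) :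
    tensorUnitMap V t ∘ₗ (V.tensor (const R S (ModuleCat.of R R))).transport γ = V.transport γ ∘ₗ tensorUnitMap V s :=
  TensorProduct.ext' fun v r => by
    change r • V.transport γ v = V.transport γ (r • v)
    rw [map_smul]

/-- Pointwise form of `tensorUnitMap_comp_transport`. [cite: Deligne1970, I.1] -/
theorem tensorUnitMap_transport (V : LocalSystem R S) {s t : S} (γ : Path.Homotopic.Quotient s t) (z : (V.tensor (const R S (ModuleCat.of R R))).fiber s) :
    tensorUnitMap V t ((V.tensor (const R S (ModuleCat.of R R))).transport γ z) = V.transport γ (tensorUnitMap V s z) :=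
  LinearMap.congr_fun (tensorUnitMap_comp_transport V γ) z

/-- **`rid⁻¹` is flat.** [cite: Deligne1970, I.1] -/
theorem tensorUnitInvMap_transport (V : LocalSystem R S) {s t : S} (γ : Path.Homotopic.Quotient s t) (v : V.fiber s) :
    tensorUnitInvMap V t (V.transport γ v) = (V.tensor (const R S (ModuleCat.of R R))).transport γ (tensorUnitInvMap V s v) := rfl

/-- `rid⁻¹ ∘ rid = id`. [cite: Deligne1970, I.1] -/
theorem tensorUnitInvMap_tensorUnitMap (V : LocalSystem R S) (s : S) (z : (V.tensor (const R S (ModuleCat.of R R))).fiber s) :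
    tensorUnitInvMap V s (tensorUnitMap V s z) = z :=
  (TensorProduct.rid R (V.fiber s)).symm_apply_apply z

/-- `rid ∘ rid⁻¹ = id`. [cite: Deligne1970, I.1] -/
theorem tensorUnitMap_tensorUnitInvMap (V : LocalSystem R S) (s : S) (v : V.fiber s) : tensorUnitMap V s (tensorUnitInvMap V s v) = v :=
  (TensorProduct.rid R (V.fiber s)).apply_symm_apply v

end LocalSystem

namespace VHSData

variable {S : Type} [TopologicalSpace S] {k k₁ k₂ k₃ : ℤ}

/-- Two additive maps out of `M ⊗ N` agreeing on pure tensors are equal (stated over a general commutative semiring, so that no instance on an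
iterated tensor product over `ℤ` is ever synthesized). [folklore] -/
private theorem addMonoidHom_ext_tmul {R : Type*} [CommSemiring R] {M N P : Type*} [AddCommMonoid M] [Module R M] [AddCommMonoid N] [Module R N]
    [AddCommMonoid P] {f g : M ⊗[R] N →+ P} (h : ∀ (m : M) (n : N), f (m ⊗ₜ[R] n) = g (m ⊗ₜ[R] n)) : f = g :=
  AddMonoidHom.ext fun z => TensorProduct.induction_on z (by rw [map_zero, map_zero]) h fun x y hx hy => by rw [map_add, map_add, hx, hy]

/-- Two additive maps out of `(M ⊗ N) ⊗ L` agreeing on the `(m ⊗ n) ⊗ l` are equal. [folklore] -/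
private theorem addMonoidHom_ext_tmul_tmul {R : Type*} [CommSemiring R] {M N L P : Type*} [AddCommMonoid M] [Module R M] [AddCommMonoid N] [Module R N]
    [AddCommMonoid L] [Module R L] [AddCommMonoid P] {f g : (M ⊗[R] N) ⊗[R] L →+ P}
    (h : ∀ (m : M) (n : N) (l : L), f (m ⊗ₜ[R] n ⊗ₜ[R] l) = g (m ⊗ₜ[R] n ⊗ₜ[R] l)) : f = g :=
  addMonoidHom_ext_tmul fun x l => TensorProduct.induction_on x (by rw [TensorProduct.zero_tmul, map_zero, map_zero]) (fun m n => h m n l)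
    fun x y hx hy => by rw [TensorProduct.add_tmul, map_add, map_add, hx, hy]

/-- Two additive maps out of `M ⊗ (N ⊗ L)` agreeing on the `m ⊗ (n ⊗ l)` are equal. [folklore] -/
private theorem addMonoidHom_ext_tmul_tmul' {R : Type*} [CommSemiring R] {M N L P : Type*} [AddCommMonoid M] [Module R M] [AddCommMonoid N] [Module R N]
    [AddCommMonoid L] [Module R L] [AddCommMonoid P] {f g : M ⊗[R] (N ⊗[R] L) →+ P}
    (h : ∀ (m : M) (n : N) (l : L), f (m ⊗ₜ[R] (n ⊗ₜ[R] l)) = g (m ⊗ₜ[R] (n ⊗ₜ[R] l))) : f = g :=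
  addMonoidHom_ext_tmul fun m x => TensorProduct.induction_on x (by rw [TensorProduct.tmul_zero, map_zero, map_zero]) (fun n l => h m n l)
    fun x y hx hy => by rw [TensorProduct.tmul_add, map_add, map_add, hx, hy]

/-! ## §1 The commutativity constraint `D₁ ⊗ D₂ ≅ D₂ ⊗ D₁` -/

section Comm

variable (D₁ : VHSData S k₁) (D₂ : VHSData S k₂)

/-- The rationalization of `comm` on the lattices `V₁,ℤ,s ⊗ V₂,ℤ,s` is `comm` on `V₁,s ⊗ V₂,s`. [cite: Deligne1970, I.1] [cite: Schmid1973, §2] -/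
theorem homRat_tensorComm (s : S) :
    (D₁.tensor D₂).homRat ((D₂.tensor D₁).cast (add_comm k₂ k₁)) s (LocalSystem.tensorCommMap D₁.VZ D₂.VZ s) = LocalSystem.tensorCommMap D₁.V D₂.V s := by
  let F : D₁.VZ.fiber s ⊗[ℤ] D₂.VZ.fiber s →+ D₂.V.fiber s ⊗[ℚ] D₁.V.fiber s :=
    (LocalSystem.tensorCommMap D₁.V D₂.V s).toAddMonoidHom.comp ((D₁.tensor D₂).toRat s)
  let G : D₁.VZ.fiber s ⊗[ℤ] D₂.VZ.fiber s →+ D₂.V.fiber s ⊗[ℚ] D₁.V.fiber s :=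
    ((D₂.tensor D₁).toRat s).comp (LocalSystem.tensorCommMap D₁.VZ D₂.VZ s).toAddMonoidHom
  have key : F = G := addMonoidHom_ext_tmul fun m₁ m₂ => by
    change LocalSystem.tensorCommMap D₁.V D₂.V s ((D₁.tensor D₂).toRat s (m₁ ⊗ₜ[ℤ] m₂)) = (D₂.tensor D₁).toRat s (m₂ ⊗ₜ[ℤ] m₁)
    rw [tensor_toRat_tmul, tensor_toRat_tmul]
    rfl
  exact ((D₁.tensor D₂).homRat_unique ((D₂.tensor D₁).cast (add_comm k₂ k₁)) s _ _ fun m => DFunLike.congr_fun key m).symm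

/-- **The commutativity constraint `ψ : D₁ ⊗ D₂ → D₂ ⊗ D₁`** of VHS data (weights `k₁ + k₂` and `k₂ + k₁`, matched by `cast`): lattice maps
`u₁ ⊗ u₂ ↦ u₂ ⊗ u₁`, flat (transport acts factorwise), Hodge by the tree's commutativity constraint of `ℚ`-Hodge structures
`HodgeStructure.Hom.tensorComm`. [cite: DeligneMilne1982Tannakian, §1 Def. 1.1] [cite: Deligne1970, I.1] [cite: DeligneHodgeII1971, 1.1.12] -/
def Hom.tensorComm : Hom (D₁.tensor D₂) ((D₂.tensor D₁).cast (add_comm k₂ k₁)) :=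
  Hom.ofFlat (fun s => LocalSystem.tensorCommMap D₁.VZ D₂.VZ s) (fun γ u => LocalSystem.tensorCommMap_transport D₁.VZ D₂.VZ γ u) fun s p => by
    haveI : HodgeTensorFacts.{0, 0} := hodgeTensorFacts_holds
    rw [homRat_tensorComm]
    exact (HodgeStructure.Hom.tensorComm (D₁.hodge s) (D₂.hodge s)).map_F_le p

/-- **The inverse commutativity constraint `ψ⁻¹ : (D₂ ⊗ D₁).cast → D₁ ⊗ D₂`.** [cite: DeligneMilne1982Tannakian, §1 Def. 1.1] [cite: Deligne1970, I.1] -/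
def Hom.tensorCommSymm : Hom ((D₂.tensor D₁).cast (add_comm k₂ k₁)) (D₁.tensor D₂) :=
  Hom.ofFlat (fun s => LocalSystem.tensorCommMap D₂.VZ D₁.VZ s) (fun γ u => LocalSystem.tensorCommMap_transport D₂.VZ D₁.VZ γ u) fun s p => by
    haveI : HodgeTensorFacts.{0, 0} := hodgeTensorFacts_holds
    have h : ((D₂.tensor D₁).cast (add_comm k₂ k₁)).homRat (D₁.tensor D₂) s (LocalSystem.tensorCommMap D₂.VZ D₁.VZ s) =
        LocalSystem.tensorCommMap D₂.V D₁.V s :=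
      D₂.homRat_tensorComm D₁ s
    rw [h]
    exact (HodgeStructure.Hom.tensorCommSymm (D₁.hodge s) (D₂.hodge s)).map_F_le p

/-- `ψ` on lattices is `comm`. [cite: Deligne1970, I.1] -/
@[simp] theorem Hom.tensorComm_app (s : S) : (Hom.tensorComm D₁ D₂).app s = LocalSystem.tensorCommMap D₁.VZ D₂.VZ s := rfl

/-- `ψ⁻¹` on lattices is `comm` (the other way). [cite: Deligne1970, I.1] -/
@[simp] theorem Hom.tensorCommSymm_app (s : S) : (Hom.tensorCommSymm D₁ D₂).app s = LocalSystem.tensorCommMap D₂.VZ D₁.VZ s := rfl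

/-- `ψ (u₁ ⊗ u₂) = u₂ ⊗ u₁`. [cite: Deligne1970, I.1] -/
theorem Hom.tensorComm_app_tmul (s : S) (u₁ : D₁.VZ.fiber s) (u₂ : D₂.VZ.fiber s) :
    (Hom.tensorComm D₁ D₂).app s (u₁ ⊗ₜ[ℤ] u₂) = u₂ ⊗ₜ[ℤ] u₁ := rfl

/-- `ψ⁻¹ ∘ ψ = id`. [cite: DeligneMilne1982Tannakian, §1 Def. 1.1] -/
theorem Hom.tensorCommSymm_comp_tensorComm : (Hom.tensorCommSymm D₁ D₂).comp (Hom.tensorComm D₁ D₂) = Hom.id (D₁.tensor D₂) :=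
  Hom.ext_of_app _ _ fun s => LinearMap.ext fun u => LocalSystem.tensorCommMap_tensorCommMap D₁.VZ D₂.VZ s u

/-- `ψ ∘ ψ⁻¹ = id`. [cite: DeligneMilne1982Tannakian, §1 Def. 1.1] -/
theorem Hom.tensorComm_comp_tensorCommSymm :
    (Hom.tensorComm D₁ D₂).comp (Hom.tensorCommSymm D₁ D₂) = Hom.id ((D₂.tensor D₁).cast (add_comm k₂ k₁)) :=
  Hom.ext_of_app _ _ fun s => LinearMap.ext fun u => LocalSystem.tensorCommMap_tensorCommMap D₂.VZ D₁.VZ s u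

/-- `ψ` carries a Hodge class `z` of `D₁ ⊗ D₂` to a Hodge class of `D₂ ⊗ D₁` of the same level (the tensorial Hodge loci of `D₁ ⊗ D₂` and `D₂ ⊗ D₁`
correspond). [cite: DeligneHodgeII1971, 1.1.12] -/
theorem isHodgeAt_tensorComm_app (s : S) (p : ℤ) {z : (D₁.tensor D₂).VZ.fiber s} (hz : (D₁.tensor D₂).IsHodgeAt s p z) :
    (D₂.tensor D₁).IsHodgeAt s p ((Hom.tensorComm D₁ D₂).app s z) :=
  ((D₂.tensor D₁).isHodgeAt_cast_iff (add_comm k₂ k₁) s p _).1 ((Hom.tensorComm D₁ D₂).isHodgeAt_app hz)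

end Comm

/-! ## §2 The associativity constraint `(D₁ ⊗ D₂) ⊗ D₃ ≅ D₁ ⊗ (D₂ ⊗ D₃)` -/

section Assoc

variable (D₁ : VHSData S k₁) (D₂ : VHSData S k₂) (D₃ : VHSData S k₃)

/-- The rationalization of `assoc` on lattices is `assoc` on the rational fibres. [cite: Deligne1970, I.1] [cite: Schmid1973, §2] -/
theorem homRat_tensorAssoc (s : S) :
    ((D₁.tensor D₂).tensor D₃).homRat ((D₁.tensor (D₂.tensor D₃)).cast (add_assoc k₁ k₂ k₃).symm) s (LocalSystem.tensorAssocMap D₁.VZ D₂.VZ D₃.VZ s) =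
      LocalSystem.tensorAssocMap D₁.V D₂.V D₃.V s := by
  -- on pure tensors both sides are `toRat m₁ ⊗ (toRat m₂ ⊗ toRat m₃)`, definitionally (`tensor_toRat_tmul`, `assoc_tmul` are `rfl`)
  have key : (LocalSystem.tensorAssocMap D₁.V D₂.V D₃.V s).toAddMonoidHom.comp (((D₁.tensor D₂).tensor D₃).toRat s) =
      ((D₁.tensor (D₂.tensor D₃)).toRat s).comp (LocalSystem.tensorAssocMap D₁.VZ D₂.VZ D₃.VZ s).toAddMonoidHom :=
    addMonoidHom_ext_tmul_tmul fun m₁ m₂ m₃ =>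
      show LocalSystem.tensorAssocMap D₁.V D₂.V D₃.V s ((D₁.toRat s m₁ ⊗ₜ[ℚ] D₂.toRat s m₂) ⊗ₜ[ℚ] D₃.toRat s m₃) =
        D₁.toRat s m₁ ⊗ₜ[ℚ] (D₂.toRat s m₂ ⊗ₜ[ℚ] D₃.toRat s m₃) from rfl
  exact (((D₁.tensor D₂).tensor D₃).homRat_unique ((D₁.tensor (D₂.tensor D₃)).cast (add_assoc k₁ k₂ k₃).symm) s _ _
    fun m => DFunLike.congr_fun key m).symm

/-- **The associativity constraint `(D₁ ⊗ D₂) ⊗ D₃ → D₁ ⊗ (D₂ ⊗ D₃)`** of VHS data (weights matched by `cast`): lattice maps `TensorProduct.assoc`,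
flat (transport acts factorwise), Hodge by the tree's `HodgeStructure.Hom.tensorAssoc`. [cite: DeligneMilne1982Tannakian, §1 Def. 1.1]
[cite: Deligne1970, I.1] [cite: DeligneHodgeII1971, 1.1.12] -/
def Hom.tensorAssoc : Hom ((D₁.tensor D₂).tensor D₃) ((D₁.tensor (D₂.tensor D₃)).cast (add_assoc k₁ k₂ k₃).symm) :=
  Hom.ofFlat (fun s => LocalSystem.tensorAssocMap D₁.VZ D₂.VZ D₃.VZ s) (fun γ u => LocalSystem.tensorAssocMap_transport D₁.VZ D₂.VZ D₃.VZ γ u)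
    fun s p => by
      haveI : HodgeTensorFacts.{0, 0} := hodgeTensorFacts_holds
      rw [homRat_tensorAssoc]
      exact (HodgeStructure.Hom.tensorAssoc (D₁.hodge s) (D₂.hodge s) (D₃.hodge s)).map_F_le p

/-- The rationalization of `assoc⁻¹` on lattices is `assoc⁻¹` on the rational fibres. [cite: Deligne1970, I.1] [cite: Schmid1973, §2] -/
theorem homRat_tensorAssocSymm (s : S) :
    ((D₁.tensor (D₂.tensor D₃)).cast (add_assoc k₁ k₂ k₃).symm).homRat ((D₁.tensor D₂).tensor D₃) s (LocalSystem.tensorAssocInvMap D₁.VZ D₂.VZ D₃.VZ s) =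
      LocalSystem.tensorAssocInvMap D₁.V D₂.V D₃.V s := by
  have key : (LocalSystem.tensorAssocInvMap D₁.V D₂.V D₃.V s).toAddMonoidHom.comp ((D₁.tensor (D₂.tensor D₃)).toRat s) =
      (((D₁.tensor D₂).tensor D₃).toRat s).comp (LocalSystem.tensorAssocInvMap D₁.VZ D₂.VZ D₃.VZ s).toAddMonoidHom :=
    addMonoidHom_ext_tmul_tmul' fun m₁ m₂ m₃ =>
      show LocalSystem.tensorAssocInvMap D₁.V D₂.V D₃.V s (D₁.toRat s m₁ ⊗ₜ[ℚ] (D₂.toRat s m₂ ⊗ₜ[ℚ] D₃.toRat s m₃)) =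
        (D₁.toRat s m₁ ⊗ₜ[ℚ] D₂.toRat s m₂) ⊗ₜ[ℚ] D₃.toRat s m₃ from rfl
  exact (((D₁.tensor (D₂.tensor D₃)).cast (add_assoc k₁ k₂ k₃).symm).homRat_unique ((D₁.tensor D₂).tensor D₃) s _ _
    fun m => DFunLike.congr_fun key m).symm

/-- **The inverse associativity constraint `D₁ ⊗ (D₂ ⊗ D₃) → (D₁ ⊗ D₂) ⊗ D₃`** (Deligne–Milne's `φ`). [cite: DeligneMilne1982Tannakian, §1 Def. 1.1]
[cite: Deligne1970, I.1] -/
def Hom.tensorAssocSymm : Hom ((D₁.tensor (D₂.tensor D₃)).cast (add_assoc k₁ k₂ k₃).symm) ((D₁.tensor D₂).tensor D₃) :=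
  Hom.ofFlat (fun s => LocalSystem.tensorAssocInvMap D₁.VZ D₂.VZ D₃.VZ s) (fun γ u => LocalSystem.tensorAssocInvMap_transport D₁.VZ D₂.VZ D₃.VZ γ u)
    fun s p => by
      haveI : HodgeTensorFacts.{0, 0} := hodgeTensorFacts_holds
      rw [homRat_tensorAssocSymm]
      exact (HodgeStructure.Hom.tensorAssocSymm (D₁.hodge s) (D₂.hodge s) (D₃.hodge s)).map_F_le p

/-- The associativity constraint on lattices is `assoc`. [cite: Deligne1970, I.1] -/
@[simp] theorem Hom.tensorAssoc_app (s : S) : (Hom.tensorAssoc D₁ D₂ D₃).app s = LocalSystem.tensorAssocMap D₁.VZ D₂.VZ D₃.VZ s := rfl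

/-- The inverse associativity constraint on lattices is `assoc⁻¹`. [cite: Deligne1970, I.1] -/
@[simp] theorem Hom.tensorAssocSymm_app (s : S) : (Hom.tensorAssocSymm D₁ D₂ D₃).app s = LocalSystem.tensorAssocInvMap D₁.VZ D₂.VZ D₃.VZ s := rfl

/-- `assoc⁻¹ ∘ assoc = id`. [cite: DeligneMilne1982Tannakian, §1 Def. 1.1] -/
theorem Hom.tensorAssocSymm_comp_tensorAssoc :
    (Hom.tensorAssocSymm D₁ D₂ D₃).comp (Hom.tensorAssoc D₁ D₂ D₃) = Hom.id ((D₁.tensor D₂).tensor D₃) :=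
  Hom.ext_of_app _ _ fun s => LinearMap.ext fun u => LocalSystem.tensorAssocInvMap_tensorAssocMap D₁.VZ D₂.VZ D₃.VZ s u

/-- `assoc ∘ assoc⁻¹ = id`. [cite: DeligneMilne1982Tannakian, §1 Def. 1.1] -/
theorem Hom.tensorAssoc_comp_tensorAssocSymm :
    (Hom.tensorAssoc D₁ D₂ D₃).comp (Hom.tensorAssocSymm D₁ D₂ D₃) = Hom.id ((D₁.tensor (D₂.tensor D₃)).cast (add_assoc k₁ k₂ k₃).symm) :=
  Hom.ext_of_app _ _ fun s => LinearMap.ext fun u => LocalSystem.tensorAssocMap_tensorAssocInvMap D₁.VZ D₂.VZ D₃.VZ s u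

end Assoc

/-! ## §3 The Tate twist as a tensor product: `ℤ_S(j) ⊗ D ≅ D(j)` -/

section Tate

variable (j : ℤ) (D : VHSData S k)

/-- The rationalization of `r ⊗ u ↦ r·u : ℤ ⊗ V_ℤ,s → V_ℤ,s` out of `ℤ_S(j) ⊗ D` is `q ⊗ v ↦ q·v : ℚ ⊗ V_s → V_s`. [cite: DeligneHodgeII1971, 2.1.14] [cite: Schmid1973, §2] -/
theorem homRat_tateTensor (s : S) :
    ((tate S j).tensor D).homRat ((D.tateTwist j).cast (HodgeStructure.tateTensor_weight k j)) s (LocalSystem.unitTensorMap D.VZ s) =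
      LocalSystem.unitTensorMap D.V s := by
  have key : (LocalSystem.unitTensorMap D.V s).toAddMonoidHom.comp (((tate S j).tensor D).toRat s) =
      (D.toRat s).comp (LocalSystem.unitTensorMap D.VZ s).toAddMonoidHom :=
    addMonoidHom_ext_tmul (M := ℤ) fun r m => by
      change LocalSystem.unitTensorMap D.V s (((tate S j).tensor D).toRat s (r ⊗ₜ[ℤ] m)) =
        D.toRatLinear ⟨s⟩ (LocalSystem.unitTensorMap D.VZ s (r ⊗ₜ[ℤ] m))
      rw [tensor_toRat_tmul, tate_toRat, LocalSystem.unitTensorMap_tmul, (D.toRatLinear ⟨s⟩).map_smul, ← Int.cast_smul_eq_zsmul ℚ,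
        toRatLinear_apply]
      exact LocalSystem.unitTensorMap_tmul D.V s (r : ℚ) (D.toRat s m)
  exact (((tate S j).tensor D).homRat_unique ((D.tateTwist j).cast (HodgeStructure.tateTensor_weight k j)) s _ _
    fun m => DFunLike.congr_fun key m).symm

/-- **`ℤ_S(j) ⊗ D → D(j)`** (Hodge II 2.1.14 «`H(n) := H ⊗ ℤ(n)`», fibrewise and flat): lattice maps `r ⊗ u ↦ r·u` (an isomorphism
`ℤ ⊗ V_ℤ,s ≅ V_ℤ,s`), flat because transport is linear, Hodge by the tree's `HodgeStructure.Hom.tateTensor` (`ℚ(j) ⊗ H → H(j)`); the target weight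
`k − 2j` is matched to `−2j + k` by `cast`. [cite: DeligneHodgeII1971, 2.1.13–2.1.14] [cite: Moonen2017FamiliesMotives, §2.1 (p. 3)] [cite: Deligne1970, I.1] -/
def Hom.tateTensor : Hom ((tate S j).tensor D) ((D.tateTwist j).cast (HodgeStructure.tateTensor_weight k j)) :=
  Hom.ofFlat (fun s => LocalSystem.unitTensorMap D.VZ s) (fun γ u => LocalSystem.unitTensorMap_transport D.VZ γ u) fun s p => by
    haveI : HodgeTensorFacts.{0, 0} := hodgeTensorFacts_holds
    rw [homRat_tateTensor]
    exact (HodgeStructure.Hom.tateTensor j (D.hodge s)).map_F_le p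

/-- The rationalization of `u ↦ 1 ⊗ u : V_ℤ,s → ℤ ⊗ V_ℤ,s` into `ℤ_S(j) ⊗ D` is `v ↦ 1 ⊗ v`. [cite: DeligneHodgeII1971, 2.1.14] [cite: Schmid1973, §2] -/
theorem homRat_tateTensorSymm (s : S) :
    ((D.tateTwist j).cast (HodgeStructure.tateTensor_weight k j)).homRat ((tate S j).tensor D) s (LocalSystem.unitTensorInvMap D.VZ s) =
      LocalSystem.unitTensorInvMap D.V s :=
  (((D.tateTwist j).cast (HodgeStructure.tateTensor_weight k j)).homRat_unique ((tate S j).tensor D) s _ _ fun m => by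
    change (1 : ℚ) ⊗ₜ[ℚ] D.toRat s m = (tate S j).toRat s (1 : ℤ) ⊗ₜ[ℚ] D.toRat s m
    rw [tate_toRat, Int.cast_one]
    rfl).symm

/-- **`D(j) → ℤ_S(j) ⊗ D`**, the inverse (lattice maps `u ↦ 1 ⊗ u`; the tree's `HodgeStructure.Hom.tateTensorSymm`). [cite: DeligneHodgeII1971, 2.1.13–2.1.14]
[cite: Moonen2017FamiliesMotives, §2.1 (p. 3)] -/
def Hom.tateTensorSymm : Hom ((D.tateTwist j).cast (HodgeStructure.tateTensor_weight k j)) ((tate S j).tensor D) :=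
  Hom.ofFlat (fun s => LocalSystem.unitTensorInvMap D.VZ s) (fun γ u => LocalSystem.unitTensorInvMap_transport D.VZ γ u) fun s p => by
    haveI : HodgeTensorFacts.{0, 0} := hodgeTensorFacts_holds
    rw [homRat_tateTensorSymm]
    exact (HodgeStructure.Hom.tateTensorSymm j (D.hodge s)).map_F_le p

/-- `ℤ_S(j) ⊗ D → D(j)` on lattices is `r ⊗ u ↦ r·u`. [cite: DeligneHodgeII1971, 2.1.14] -/
@[simp] theorem Hom.tateTensor_app (s : S) : (Hom.tateTensor j D).app s = LocalSystem.unitTensorMap D.VZ s := rfl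

/-- `D(j) → ℤ_S(j) ⊗ D` on lattices is `u ↦ 1 ⊗ u`. [cite: DeligneHodgeII1971, 2.1.14] -/
@[simp] theorem Hom.tateTensorSymm_app (s : S) : (Hom.tateTensorSymm j D).app s = LocalSystem.unitTensorInvMap D.VZ s := rfl

/-- `(D(j) → ℤ_S(j) ⊗ D) ∘ (ℤ_S(j) ⊗ D → D(j)) = id`. [cite: DeligneHodgeII1971, 2.1.14] -/
theorem Hom.tateTensorSymm_comp_tateTensor : (Hom.tateTensorSymm j D).comp (Hom.tateTensor j D) = Hom.id ((tate S j).tensor D) :=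
  Hom.ext_of_app _ _ fun s => LinearMap.ext fun u => LocalSystem.unitTensorInvMap_unitTensorMap D.VZ s u

/-- `(ℤ_S(j) ⊗ D → D(j)) ∘ (D(j) → ℤ_S(j) ⊗ D) = id`. [cite: DeligneHodgeII1971, 2.1.14] -/
theorem Hom.tateTensor_comp_tateTensorSymm :
    (Hom.tateTensor j D).comp (Hom.tateTensorSymm j D) = Hom.id ((D.tateTwist j).cast (HodgeStructure.tateTensor_weight k j)) :=
  Hom.ext_of_app _ _ fun s => LinearMap.ext fun u => LocalSystem.unitTensorMap_unitTensorInvMap D.VZ s u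

/-- **`1 ⊗ u ∈ ℤ(j)_s ⊗ V_ℤ,s` is a Hodge class of level `p` of `ℤ_S(j) ⊗ D` iff `u` is a Hodge class of level `p + j` of `D`** (transport through
`ℤ_S(j) ⊗ D ≅ D(j)` and `isHodgeAt_tateTwist_iff`). [cite: DeligneHodgeII1971, 2.1.14] [cite: CattaniDeligneKaplan1995, §1] -/
theorem isHodgeAt_tateTensor_one_tmul_iff (s : S) (p : ℤ) (u : D.VZ.fiber s) :
    ((tate S j).tensor D).IsHodgeAt s p (LocalSystem.unitTensorInvMap D.VZ s u) ↔ D.IsHodgeAt s (p + j) u := by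
  constructor
  · intro h
    have h' := (Hom.tateTensor j D).isHodgeAt_app h
    rw [isHodgeAt_cast_iff, isHodgeAt_tateTwist_iff] at h'
    have hu : (Hom.tateTensor j D).app s (LocalSystem.unitTensorInvMap D.VZ s u) = u := LocalSystem.unitTensorMap_unitTensorInvMap D.VZ s u
    rwa [hu] at h'
  · intro h
    exact (Hom.tateTensorSymm j D).isHodgeAt_app
      (((D.tateTwist j).isHodgeAt_cast_iff (HodgeStructure.tateTensor_weight k j) s p u).2 ((D.isHodgeAt_tateTwist_iff j s p u).2 h))

/-- `unitTensorInvMap u = 1 ⊗ u` for lattices of VHS data (restated at `R = ℤ`). [cite: Deligne1970, I.1] -/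
theorem unitTensorInvMap_VZ_apply (s : S) (u : D.VZ.fiber s) : LocalSystem.unitTensorInvMap D.VZ s u = (1 : ℤ) ⊗ₜ[ℤ] u := rfl

end Tate

/-! ## §4 The unitors `ℤ_S ⊗ D ≅ D ≅ D ⊗ ℤ_S` -/

section Unit

variable (D : VHSData S k)

/-- The rationalization of `r ⊗ u ↦ r·u` out of `ℤ_S ⊗ D` is `q ⊗ v ↦ q·v`. [cite: Deligne1970, I.1] [cite: Schmid1973, §2] -/
theorem homRat_unitTensor (s : S) :
    ((unit S).tensor D).homRat (D.cast (zero_add k).symm) s (LocalSystem.unitTensorMap D.VZ s) = LocalSystem.unitTensorMap D.V s := by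
  have key : (LocalSystem.unitTensorMap D.V s).toAddMonoidHom.comp (((unit S).tensor D).toRat s) =
      (D.toRat s).comp (LocalSystem.unitTensorMap D.VZ s).toAddMonoidHom :=
    addMonoidHom_ext_tmul (M := ℤ) fun r m => by
      change LocalSystem.unitTensorMap D.V s (((unit S).tensor D).toRat s (r ⊗ₜ[ℤ] m)) =
        D.toRatLinear ⟨s⟩ (LocalSystem.unitTensorMap D.VZ s (r ⊗ₜ[ℤ] m))
      rw [tensor_toRat_tmul, unit_toRat, LocalSystem.unitTensorMap_tmul, (D.toRatLinear ⟨s⟩).map_smul, ← Int.cast_smul_eq_zsmul ℚ,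
        toRatLinear_apply]
      exact LocalSystem.unitTensorMap_tmul D.V s (r : ℚ) (D.toRat s m)
  exact (((unit S).tensor D).homRat_unique (D.cast (zero_add k).symm) s _ _ fun m => DFunLike.congr_fun key m).symm

/-- **The left unitor `ℤ_S ⊗ D → D`** (weights `0 + k` and `k`, matched by `cast`): lattice maps `r ⊗ u ↦ r·u`, Hodge by the tree's left unitor
`HodgeStructure.Hom.tensorLid` of the identity object `ℚ(0)`. [cite: DeligneMilne1982Tannakian, §1 Prop. 1.3] [cite: Deligne1970, I.1] -/
def Hom.unitTensor : Hom ((unit S).tensor D) (D.cast (zero_add k).symm) :=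
  Hom.ofFlat (fun s => LocalSystem.unitTensorMap D.VZ s) (fun γ u => LocalSystem.unitTensorMap_transport D.VZ γ u) fun s p => by
    haveI : HodgeTensorFacts.{0, 0} := hodgeTensorFacts_holds
    rw [homRat_unitTensor]
    exact (HodgeStructure.Hom.tensorLid (D.hodge s)).map_F_le p

/-- The rationalization of `u ↦ 1 ⊗ u` into `ℤ_S ⊗ D` is `v ↦ 1 ⊗ v`. [cite: Deligne1970, I.1] [cite: Schmid1973, §2] -/
theorem homRat_unitTensorSymm (s : S) :
    (D.cast (zero_add k).symm).homRat ((unit S).tensor D) s (LocalSystem.unitTensorInvMap D.VZ s) = LocalSystem.unitTensorInvMap D.V s :=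
  ((D.cast (zero_add k).symm).homRat_unique ((unit S).tensor D) s _ _ fun m => by
    change (1 : ℚ) ⊗ₜ[ℚ] D.toRat s m = (unit S).toRat s (1 : ℤ) ⊗ₜ[ℚ] D.toRat s m
    rw [unit_toRat, Int.cast_one]
    rfl).symm

/-- **`ℓ_D : D → ℤ_S ⊗ D`**, the inverse left unitor (lattice maps `u ↦ 1 ⊗ u`). [cite: DeligneMilne1982Tannakian, §1 Prop. 1.3] [cite: Deligne1970, I.1] -/
def Hom.unitTensorSymm : Hom (D.cast (zero_add k).symm) ((unit S).tensor D) :=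
  Hom.ofFlat (fun s => LocalSystem.unitTensorInvMap D.VZ s) (fun γ u => LocalSystem.unitTensorInvMap_transport D.VZ γ u) fun s p => by
    haveI : HodgeTensorFacts.{0, 0} := hodgeTensorFacts_holds
    rw [homRat_unitTensorSymm]
    exact (HodgeStructure.Hom.tensorLidSymm (D.hodge s)).map_F_le p

/-- `ℓ_D ∘ (ℤ_S ⊗ D → D) = id`. [cite: DeligneMilne1982Tannakian, §1 Prop. 1.3] -/
theorem Hom.unitTensorSymm_comp_unitTensor : (Hom.unitTensorSymm D).comp (Hom.unitTensor D) = Hom.id ((unit S).tensor D) :=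
  Hom.ext_of_app _ _ fun s => LinearMap.ext fun u => LocalSystem.unitTensorInvMap_unitTensorMap D.VZ s u

/-- `(ℤ_S ⊗ D → D) ∘ ℓ_D = id`. [cite: DeligneMilne1982Tannakian, §1 Prop. 1.3] -/
theorem Hom.unitTensor_comp_unitTensorSymm : (Hom.unitTensor D).comp (Hom.unitTensorSymm D) = Hom.id (D.cast (zero_add k).symm) :=
  Hom.ext_of_app _ _ fun s => LinearMap.ext fun u => LocalSystem.unitTensorMap_unitTensorInvMap D.VZ s u

/-- The rationalization of `u ⊗ r ↦ r·u` out of `D ⊗ ℤ_S` is `v ⊗ q ↦ q·v`. [cite: Deligne1970, I.1] [cite: Schmid1973, §2] -/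
theorem homRat_tensorUnit (s : S) :
    (D.tensor (unit S)).homRat (D.cast (add_zero k).symm) s (LocalSystem.tensorUnitMap D.VZ s) = LocalSystem.tensorUnitMap D.V s := by
  have key : (LocalSystem.tensorUnitMap D.V s).toAddMonoidHom.comp ((D.tensor (unit S)).toRat s) =
      (D.toRat s).comp (LocalSystem.tensorUnitMap D.VZ s).toAddMonoidHom :=
    addMonoidHom_ext_tmul (N := ℤ) fun m r => by
      change LocalSystem.tensorUnitMap D.V s ((D.tensor (unit S)).toRat s (m ⊗ₜ[ℤ] r)) =
        D.toRatLinear ⟨s⟩ (LocalSystem.tensorUnitMap D.VZ s (m ⊗ₜ[ℤ] r))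
      rw [tensor_toRat_tmul, unit_toRat, LocalSystem.tensorUnitMap_tmul, (D.toRatLinear ⟨s⟩).map_smul, ← Int.cast_smul_eq_zsmul ℚ,
        toRatLinear_apply]
      exact LocalSystem.tensorUnitMap_tmul D.V s (D.toRat s m) (r : ℚ)
  exact ((D.tensor (unit S)).homRat_unique (D.cast (add_zero k).symm) s _ _ fun m => DFunLike.congr_fun key m).symm

/-- **The right unitor `D ⊗ ℤ_S → D`** (weights `k + 0` and `k`): lattice maps `u ⊗ r ↦ r·u`, Hodge by the tree's `HodgeStructure.Hom.tensorRid`.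
[cite: DeligneMilne1982Tannakian, §1 Prop. 1.3] [cite: Deligne1970, I.1] -/
def Hom.tensorUnit : Hom (D.tensor (unit S)) (D.cast (add_zero k).symm) :=
  Hom.ofFlat (fun s => LocalSystem.tensorUnitMap D.VZ s) (fun γ u => LocalSystem.tensorUnitMap_transport D.VZ γ u) fun s p => by
    haveI : HodgeTensorFacts.{0, 0} := hodgeTensorFacts_holds
    rw [homRat_tensorUnit]
    exact (HodgeStructure.Hom.tensorRid (D.hodge s)).map_F_le p

/-- The rationalization of `u ↦ u ⊗ 1` into `D ⊗ ℤ_S` is `v ↦ v ⊗ 1`. [cite: Deligne1970, I.1] [cite: Schmid1973, §2] -/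
theorem homRat_tensorUnitSymm (s : S) :
    (D.cast (add_zero k).symm).homRat (D.tensor (unit S)) s (LocalSystem.tensorUnitInvMap D.VZ s) = LocalSystem.tensorUnitInvMap D.V s :=
  ((D.cast (add_zero k).symm).homRat_unique (D.tensor (unit S)) s _ _ fun m => by
    change D.toRat s m ⊗ₜ[ℚ] (1 : ℚ) = D.toRat s m ⊗ₜ[ℚ] (unit S).toRat s (1 : ℤ)
    rw [unit_toRat, Int.cast_one]
    rfl).symm

/-- **`r_D : D → D ⊗ ℤ_S`**, the inverse right unitor (lattice maps `u ↦ u ⊗ 1`). [cite: DeligneMilne1982Tannakian, §1 Prop. 1.3] [cite: Deligne1970, I.1] -/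
def Hom.tensorUnitSymm : Hom (D.cast (add_zero k).symm) (D.tensor (unit S)) :=
  Hom.ofFlat (fun s => LocalSystem.tensorUnitInvMap D.VZ s) (fun γ u => LocalSystem.tensorUnitInvMap_transport D.VZ γ u) fun s p => by
    haveI : HodgeTensorFacts.{0, 0} := hodgeTensorFacts_holds
    rw [homRat_tensorUnitSymm]
    exact (HodgeStructure.Hom.tensorRidSymm (D.hodge s)).map_F_le p

/-- `r_D ∘ (D ⊗ ℤ_S → D) = id`. [cite: DeligneMilne1982Tannakian, §1 Prop. 1.3] -/
theorem Hom.tensorUnitSymm_comp_tensorUnit : (Hom.tensorUnitSymm D).comp (Hom.tensorUnit D) = Hom.id (D.tensor (unit S)) :=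
  Hom.ext_of_app _ _ fun s => LinearMap.ext fun u => LocalSystem.tensorUnitInvMap_tensorUnitMap D.VZ s u

/-- `(D ⊗ ℤ_S → D) ∘ r_D = id`. [cite: DeligneMilne1982Tannakian, §1 Prop. 1.3] -/
theorem Hom.tensorUnit_comp_tensorUnitSymm : (Hom.tensorUnit D).comp (Hom.tensorUnitSymm D) = Hom.id (D.cast (add_zero k).symm) :=
  Hom.ext_of_app _ _ fun s => LinearMap.ext fun u => LocalSystem.tensorUnitMap_tensorUnitInvMap D.VZ s u

end Unit

end VHSData

end Literature.AlgebraicGeometry.Motives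

end
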